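import Mathlib.CategoryTheory.Adjunction.Additive
import Mathlib.Algebra.Homology.DerivedCategory.Ext.Map
import Literature.AlgebraicGeometry.Motives.LinearSheafCohomology
import Literature.AlgebraicGeometry.Motives.ModuleSheafChangeOfRings
import HarnessLib

/-!
# Change of rings for `R`-linear sheaf cohomology: `Hⁿ_R(X, G) ≅ Hⁿ_S(X, res G)` along
# `S ↠ R = S/(a)` (Milne III Ex. 2.25), via acyclicity of `I[a]` for injective sheaves `I`

Let `(C, J)` be a site with a final object `T`, `φ : S → R` a **surjective** ring homomorphism
with kernel `(a)`, and assume `a` is part of an **exact pair** `(a, b)` of `S`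
(`ab = 0`, `ann(a) ⊆ (b)`, `ann(b) ⊆ (a)`; e.g. `S = ℤ/ℓᵐ⁺¹ ↠ R = ℤ/ℓᵐ`, `a = ℓᵐ`, `b = ℓ`, the
transition of the `ℓ`-adic tower). For a sheaf of `R`-modules `G`, its cohomology computed in
`S(X, R)` and in `S(X, S)` agree:

  `c : Hⁿ_R(X, G) = Extⁿ_R(R_X, G) ⟶ Extⁿ_S(S_X, res G) = Hⁿ_S(X, res G)`, `y ↦ r ∪ res(y)`,

`r : S_X → res R_X` the canonical map, is **bijective** (`bijective_changeOfRingsMap`) — the case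
needed for the `ℓ`-adic tower of Milne III Ex. 2.25 ("`Hᵖ(X, A, M) → Hᵖ(X, M)` is an
isomorphism"). Milne's hint is that the forgetful functor sends injectives to flabby sheaves; the
proof here replaces flabbiness by the following **acyclicity**, proved by dimension shifting:

* (`linearCohomology` engine, `eq_zero_of_shortExact_of_surjective`) for `0 → K → I → K′ → 0`
  short exact with `I` acyclic and `I(T) → K′(T)` onto: `H¹(K) = 0`, and `Hᵐ(K′) = 0 ⇒ Hᵐ⁺¹(K) = 0`;
* (`eq_zero_kernel_smul_of_injective`) for an injective sheaf of `S`-modules `I₀` the sequences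
  `0 → I₀[a] → I₀ →a→ I₀[b] → 0`, `0 → I₀[b] → I₀ →b→ I₀[a] → 0` are short exact and onto on sections
  (sections of injective sheaves are injective modules + Baer: `a I₀(U) = I₀(U)[b]`,
  `ModuleSheafChangeOfRings.lean`), whence `Hᵐ(I₀[a]) = Hᵐ(I₀[b]) = 0` for `m ≥ 1`;
* (`eq_zero_restrictScalars_of_injective`) for an injective sheaf of `R`-modules `I`:
  `res I ↪ I₀` (injective hull over `S`) factors through `res (coind I₀) ≅ I₀[a]`, and `res I` is a
  retract of it (`I → coind I₀` is a mono out of an injective), so `Hᵐ_S(res I) = 0`, `m ≥ 1`;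
* (`bijective_changeOfRingsMap`) `c` is a morphism of `δ`-functors (`changeOfRingsMap_delta`),
  bijective in degree `0` (both sides are `G(T)`, `changeOfRingsMap_zero`), and the four-lemma
  induction along `G ↪ I ↠ I/G` with `Hᵐ_S(res I) = 0`.

Also: `c(x ∪ y) = c(x) ∘ res(y)` (`changeOfRingsMap_cup`) and `c(1) = r`, whence the **reduction of
coefficients `ρ = c⁻¹ ∘ Hⁿ(r) : Hⁿ(X, S) → Hⁿ(X, R)` is a ring homomorphism** (`reductionMap_cup`,
`reductionMap_one`) — the transition maps of the `ℓ`-adic tower `(Hⁿ(X_ét, ℤ/ℓᵐ))ₘ` with their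
cup products.

## References

* J. S. Milne, *Étale cohomology* (reissue 2025; held copy): III Ex. 2.25 (p. 119), III Rem.
  1.6 (e) (`H⁰ = Γ`), V §1 p. 175 (cohomology of `ℤ/(n)`-module sheaves vs `Exts`). [Milne2025]
* The Stacks project, Tag 03FD.

## Design notes

* Hypotheses are those of the tower (`S ↠ S/(a)`, `(a, b)` exact); the general statement of
  Milne III Ex. 2.25 (any ring map, via flabby sheaves / Čech cohomology) is not attempted.
* The final object `T` enters only through `H⁰(X, G) ≅ G(T)` (as in Mathlib's `Sheaf.H.equiv₀`)
  and the definition of `r`.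
-/

universe w u

open CategoryTheory CategoryTheory.Limits Opposite CategoryTheory.Abelian

noncomputable section

namespace Literature.AlgebraicGeometry.Motives

variable {C : Type u} [Category.{w} C] {J : GrothendieckTopology C}

/-! ### Degree `0`: `H⁰(X, G) ≅ G(T)` -/

section DegreeZero

variable {S : Type w} [CommRing S] [HasSheafify J (ModuleCat.{w} S)]
  [HasExt.{w} (Sheaf J (ModuleCat.{w} S))] {T : C} (hT : IsTerminal T)

/-- **`H⁰(X, G) ≅ G(T)`** for a sheaf of `S`-modules `G` and a final object `T`
(`Ext⁰(S_X, G) = Hom(S_X, G) = Hom_S(S, G(T)) = G(T)`; Milne III 1.6 (e), Mathlib `Sheaf.H.equiv₀`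
for abelian sheaves). [cite: Milne2025, III Remark 1.6 (e)] -/
def linearCohomologyZeroEquiv (G : Sheaf J (ModuleCat.{w} S)) :
    linearCohomology S G 0 ≃+ G.obj.obj (op T) :=
  Ext.addEquiv₀.trans <|
    ((constantSheafAdj J (ModuleCat.{w} S) hT).homAddEquiv _ G).trans <|
      (ModuleCat.homAddEquiv (M := ModuleCat.of S S) (N := G.obj.obj (op T))).trans
        (LinearMap.ringLmapEquivSelf S S (G.obj.obj (op T))).toAddEquiv

/-- The formula `e(mk₀ g) = (η ≫ g_T)(1)`. [folklore] -/
theorem linearCohomologyZeroEquiv_mk₀ (G : Sheaf J (ModuleCat.{w} S))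
    (g : constantSheafSelf J S ⟶ G) :
    linearCohomologyZeroEquiv hT G (Ext.mk₀ g) =
      ((constantSheafAdj J (ModuleCat.{w} S) hT).homEquiv _ G g).hom (1 : S) := by
  simp only [linearCohomologyZeroEquiv, AddEquiv.trans_apply]
  rw [← Ext.addEquiv₀_symm_apply, AddEquiv.apply_symm_apply]
  rfl

/-- **Naturality of `H⁰(X, G) ≅ G(T)`** in `G`. [folklore] -/
theorem linearCohomologyZeroEquiv_naturality {G G' : Sheaf J (ModuleCat.{w} S)} (ψ : G ⟶ G')
    (x : linearCohomology S G 0) :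
    linearCohomologyZeroEquiv hT G' (linearCohomology.map ψ 0 x) =
      ψ.hom.app (op T) (linearCohomologyZeroEquiv hT G x) := by
  obtain ⟨g, rfl⟩ := (Ext.mk₀_bijective _ _).2 x
  rw [linearCohomology.map_apply, Ext.mk₀_comp_mk₀, linearCohomologyZeroEquiv_mk₀,
    linearCohomologyZeroEquiv_mk₀, Adjunction.homEquiv_naturality_right]
  rfl

include hT in
/-- If `ψ_T : G(T) → G′(T)` is surjective then so is `H⁰(X, ψ)`. [folklore] -/
theorem linearCohomology.surjective_map_zero {G G' : Sheaf J (ModuleCat.{w} S)} (ψ : G ⟶ G')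
    (h : Function.Surjective (ψ.hom.app (op T))) :
    Function.Surjective (linearCohomology.map ψ 0) := by
  intro y
  obtain ⟨z, hz⟩ := h (linearCohomologyZeroEquiv hT G' y)
  refine ⟨(linearCohomologyZeroEquiv hT G).symm z, (linearCohomologyZeroEquiv hT G').injective ?_⟩
  rw [linearCohomologyZeroEquiv_naturality, AddEquiv.apply_symm_apply, hz]

end DegreeZero

/-! ### The dimension-shifting engine -/

namespace linearCohomology

variable {S : Type w} [CommRing S] [HasSheafify J (ModuleCat.{w} S)]
  [HasExt.{w} (Sheaf J (ModuleCat.{w} S))]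

/-- **Dimension shifting**: for a short exact sequence `0 → K → I → K′ → 0` of sheaves of modules
with `Hᵐ(I) = 0` for `m ≥ 1` and `H⁰(I) → H⁰(K′)` surjective, `H¹(K) = 0`; and `Hᵐ⁺¹(K′) = 0`
implies `Hᵐ⁺²(K) = 0`. [folklore] -/
theorem eq_zero_of_shortExact_of_surjective {T : ShortComplex (Sheaf J (ModuleCat.{w} S))}
    (hT : T.ShortExact) (hI : ∀ (m : ℕ) (y : linearCohomology S T.X₂ (m + 1)), y = 0)
    (h0 : Function.Surjective (map T.g 0)) :
    (∀ x : linearCohomology S T.X₁ 1, x = 0) ∧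
      ∀ m : ℕ, (∀ y : linearCohomology S T.X₃ (m + 1), y = 0) →
        ∀ x : linearCohomology S T.X₁ (m + 2), x = 0 := by
  constructor
  · intro x
    obtain ⟨z, rfl⟩ := ((exact_delta_map hT 0) x).1 (hI 0 _)
    obtain ⟨w, rfl⟩ := h0 z
    exact delta_map_eq_zero hT 0 w
  · intro m hm x
    obtain ⟨z, rfl⟩ := ((exact_delta_map hT (m + 1)) x).1 (hI (m + 1) _)
    rw [hm z, map_zero]

/-- Cohomology vanishing is invariant under isomorphism of sheaves. [folklore] -/
theorem eq_zero_of_iso {F G : Sheaf J (ModuleCat.{w} S)} (e : F ≅ G) (n : ℕ)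
    (h : ∀ y : linearCohomology S G n, y = 0) (x : linearCohomology S F n) : x = 0 := by
  have : map e.inv n (map e.hom n x) = x := by rw [← map_comp, e.hom_inv_id, map_id]
  rw [← this, h (map e.hom n x), map_zero]

/-- Cohomology vanishing passes to retracts. [folklore] -/
theorem eq_zero_of_retract {F G : Sheaf J (ModuleCat.{w} S)} (i : F ⟶ G) (r : G ⟶ F)
    (hir : i ≫ r = 𝟙 F) (n : ℕ) (h : ∀ y : linearCohomology S G n, y = 0)
    (x : linearCohomology S F n) : x = 0 := by
  have : map r n (map i n x) = x := by rw [← map_comp, hir, map_id]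
  rw [← this, h (map i n x), map_zero]

end linearCohomology

/-! ### Acyclicity of `I₀[a]`, `I₀[b]` for an injective sheaf `I₀` and an exact pair `(a, b)` -/

section KernelSmul

variable {S : Type w} [CommRing S] [HasSheafify J (ModuleCat.{w} S)]
  [HasExt.{w} (Sheaf J (ModuleCat.{w} S))]

omit [HasSheafify J (ModuleCat.{w} S)] [HasExt.{w} (Sheaf J (ModuleCat.{w} S))] in
/-- `(a · 𝟙) ≫ (b · 𝟙) = 0` on any sheaf of modules when `ab = 0`. [folklore] -/
theorem smul_id_comp_smul_id (F : Sheaf J (ModuleCat.{w} S)) {a b : S} (hab : a * b = 0) :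
    (a • 𝟙 F) ≫ (b • 𝟙 F) = 0 := by
  have hba : b * a = 0 := by rw [mul_comm, hab]
  simp only [Linear.smul_comp, Linear.comp_smul, Category.id_comp, smul_smul]
  first
  | rw [hab, zero_smul]
  | rw [hba, zero_smul]

/-- The short complex `I₀[a] ↪ I₀ ↠ I₀[b]` (`kernel (a · 𝟙) → I₀ → kernel (b · 𝟙)`, the second map
induced by `a · 𝟙`). [folklore] -/
def kernelSmulShortComplex (F : Sheaf J (ModuleCat.{w} S)) {a b : S} (hab : a * b = 0) :
    ShortComplex (Sheaf J (ModuleCat.{w} S)) :=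
  ShortComplex.mk (kernel.ι (a • 𝟙 F))
    (kernel.lift (b • 𝟙 F) (a • 𝟙 F) (smul_id_comp_smul_id F hab)) (by
      rw [← cancel_mono (kernel.ι (b • 𝟙 F)), Category.assoc, kernel.lift_ι, kernel.condition,
        zero_comp])

omit [HasExt.{w} (Sheaf J (ModuleCat.{w} S))] in
/-- `I₀[a] ↪ I₀ ↠ I₀[b]` is exact at `I₀` (the kernel of `I₀ → I₀[b] ↪ I₀`, i.e. of `a · 𝟙`, is
`I₀[a]`). [folklore] -/
theorem kernelSmulShortComplex_exact (F : Sheaf J (ModuleCat.{w} S)) {a b : S} (hab : a * b = 0) :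
    (kernelSmulShortComplex F hab).Exact :=
  ShortComplex.exact_of_f_is_kernel _
    (isKernelOfComp (kernel.ι (b • 𝟙 F)) (a • 𝟙 F) (kernelIsKernel (a • 𝟙 F))
      (kernelSmulShortComplex F hab).zero (kernel.lift_ι _ _ _))

omit [HasSheafify J (ModuleCat.{w} S)] [HasExt.{w} (Sheaf J (ModuleCat.{w} S))] in
/-- Sections of `a · 𝟙 F` are `a · id`. [folklore] -/
theorem smul_id_hom_app (F : Sheaf J (ModuleCat.{w} S)) (a : S) (U : Cᵒᵖ) :
    ((a • 𝟙 F).hom.app U).hom = a • (LinearMap.id : F.obj.obj U →ₗ[S] F.obj.obj U) :=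
  rfl

omit [HasExt.{w} (Sheaf J (ModuleCat.{w} S))] in
/-- For an **injective** sheaf of `S`-modules `I₀` and `ab = 0`, `ann(a) ⊆ (b)`: `I₀ → I₀[b]`
(induced by `a ·`) is **surjective on all sections** (Baer: `a I₀(U) = I₀(U)[b]`, sections of
injective sheaves being injective modules). [folklore] -/
theorem surjective_kernelSmulShortComplex_g_app (I₀ : Sheaf J (ModuleCat.{w} S)) [Injective I₀]
    {a b : S} (hab : a * b = 0) (ha : ∀ s : S, s * a = 0 → ∃ t, s = t * b) (U : Cᵒᵖ) :
    Function.Surjective ((kernelSmulShortComplex I₀ hab).g.hom.app U) :=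
  Sheaf.surjective_kernel_lift_app (b • 𝟙 I₀) (a • 𝟙 I₀) (smul_id_comp_smul_id I₀ hab) U (by
    rw [smul_id_hom_app, smul_id_hom_app,
      ← range_smul_id_eq_ker (moduleInjective_sections J I₀ U) a b hab ha])

omit [HasExt.{w} (Sheaf J (ModuleCat.{w} S))] in
/-- For an injective sheaf of `S`-modules `I₀` and `ab = 0`, `ann(a) ⊆ (b)`:
**`0 → I₀[a] → I₀ → I₀[b] → 0` is short exact.** [folklore] -/
theorem kernelSmulShortComplex_shortExact (I₀ : Sheaf J (ModuleCat.{w} S)) [Injective I₀]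
    {a b : S} (hab : a * b = 0) (ha : ∀ s : S, s * a = 0 → ∃ t, s = t * b) :
    (kernelSmulShortComplex I₀ hab).ShortExact where
  exact := kernelSmulShortComplex_exact I₀ hab
  mono_f := by dsimp [kernelSmulShortComplex]; infer_instance
  epi_g := Sheaf.epi_of_surjective_sections _
    (surjective_kernelSmulShortComplex_g_app I₀ hab ha)

variable {T : C} (hT : IsTerminal T)

include hT in
/-- **Acyclicity of `I₀[a]` and `I₀[b]`**: for an injective sheaf of `S`-modules `I₀` over a site
with a final object and an exact pair `(a, b)` (`ab = 0`, `ann(a) ⊆ (b)`, `ann(b) ⊆ (a)`),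
`Hᵐ(X, I₀[a]) = Hᵐ(X, I₀[b]) = 0` for all `m ≥ 1` (dimension shifting along the two short exact
sequences `I₀[a] ↪ I₀ ↠ I₀[b]`, `I₀[b] ↪ I₀ ↠ I₀[a]`, both onto on sections). This replaces "the
forgetful functor maps injectives to flabby sheaves" in Milne III Ex. 2.25. [folklore] -/
theorem eq_zero_kernel_smul_of_injective (I₀ : Sheaf J (ModuleCat.{w} S)) [Injective I₀]
    {a b : S} (hab : a * b = 0) (ha : ∀ s : S, s * a = 0 → ∃ t, s = t * b)
    (hb : ∀ s : S, s * b = 0 → ∃ t, s = t * a) (m : ℕ) :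
    (∀ x : linearCohomology S (kernel (a • 𝟙 I₀)) (m + 1), x = 0) ∧
      ∀ x : linearCohomology S (kernel (b • 𝟙 I₀)) (m + 1), x = 0 := by
  have hba : b * a = 0 := by rw [mul_comm, hab]
  have hI : ∀ (m : ℕ) (y : linearCohomology S I₀ (m + 1)), y = 0 := fun m y => Subsingleton.elim _ _
  have Ea := linearCohomology.eq_zero_of_shortExact_of_surjective
    (kernelSmulShortComplex_shortExact I₀ hab ha) hI
    (linearCohomology.surjective_map_zero hT _
      (surjective_kernelSmulShortComplex_g_app I₀ hab ha (op T)))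
  have Eb := linearCohomology.eq_zero_of_shortExact_of_surjective
    (kernelSmulShortComplex_shortExact I₀ hba hb) hI
    (linearCohomology.surjective_map_zero hT _
      (surjective_kernelSmulShortComplex_g_app I₀ hba hb (op T)))
  induction m with
  | zero => exact ⟨Ea.1, Eb.1⟩
  | succ m ih => exact ⟨Ea.2 m ih.2, Eb.2 m ih.1⟩

end KernelSmul

/-! ### `res (coind I₀) ≅ I₀[a]` and the acyclicity of `res I` for injective `R`-sheaves `I` -/

section RestrictInjective

variable {S R : Type w} [CommRing S] [CommRing R] (φ : S →+* R) (hφ : Function.Surjective φ)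
  {a : S} (hker : RingHom.ker φ = Ideal.span {a})
variable [HasSheafify J (ModuleCat.{w} S)] [HasSheafify J (ModuleCat.{w} R)]

omit [HasSheafify J (ModuleCat.{w} S)] [HasSheafify J (ModuleCat.{w} R)] in
/-- `ε ≫ (a · 𝟙) = 0` for the evaluation-at-`1` map `ε : res (coind I₀) → I₀` when `φ a = 0`.
[folklore] -/
theorem coindCounit_comp_smul_id (ha : φ a = 0) (I₀ : Sheaf J (ModuleCat.{w} S)) :
    coindCounit J φ I₀ ≫ (a • 𝟙 I₀) = 0 := by
  apply Sheaf.hom_ext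
  ext U x
  change a • (coindCounit J φ I₀).hom.app U x = 0
  exact smul_coindCounit_app_eq_zero J φ ha I₀ U x

omit [HasSheafify J (ModuleCat.{w} R)] in
include hφ hker in
/-- **`res (coind I₀) ≅ I₀[a]`**: for `φ : S ↠ R` with kernel `(a)`, the canonical map
`res (coind I₀) → kernel (a · 𝟙_{I₀})` induced by evaluation at `1` is an isomorphism (it is
injective and surjective on all sections: `Hom_S(S/(a), M) = M[a]`; a mono + epi in an abelian
category). [folklore] -/
theorem isIso_kernelLift_coindCounit (I₀ : Sheaf J (ModuleCat.{w} S)) :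
    IsIso (kernel.lift (a • 𝟙 I₀) (coindCounit J φ I₀)
      (coindCounit_comp_smul_id φ (by
        rw [← RingHom.mem_ker, hker]; exact Ideal.mem_span_singleton_self a) I₀)) := by
  have hmono : Mono (kernel.lift (a • 𝟙 I₀) (coindCounit J φ I₀) (coindCounit_comp_smul_id φ (by
      rw [← RingHom.mem_ker, hker]; exact Ideal.mem_span_singleton_self a) I₀)) := by
    haveI : Mono (coindCounit J φ I₀) :=
      Sheaf.mono_of_injective_sections _ (injective_coindCounit_app J φ hφ I₀)
    exact mono_of_mono_fac (kernel.lift_ι _ _ _)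
  have hepi : Epi (kernel.lift (a • 𝟙 I₀) (coindCounit J φ I₀) (coindCounit_comp_smul_id φ (by
      rw [← RingHom.mem_ker, hker]; exact Ideal.mem_span_singleton_self a) I₀)) := by
    apply Sheaf.epi_of_surjective_sections
    intro U
    apply Sheaf.surjective_kernel_lift_app
    rw [smul_id_hom_app, range_coindCounit_app J φ hφ hker I₀ U]
  exact isIso_of_mono_of_epi _

/-- For an adjunction `L ⊣ R'` with `L` faithful, the adjoint `X → R′ Y` of a monomorphism
`L X → Y` is a monomorphism. [folklore] -/
theorem mono_homEquiv_of_faithful {A B : Type*} [Category A] [Category B] {L : A ⥤ B} {R' : B ⥤ A}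
    (adj : L ⊣ R') [L.Faithful] {X : A} {Y : B} (f : L.obj X ⟶ Y) [Mono f] :
    Mono (adj.homEquiv X Y f) := by
  refine ⟨fun u v huv => L.map_injective ((cancel_mono f).1 ?_)⟩
  have := congrArg (adj.homEquiv _ Y).symm huv
  rwa [adj.homEquiv_naturality_left_symm, adj.homEquiv_naturality_left_symm,
    Equiv.symm_apply_apply] at this

variable [IsGrothendieckAbelian.{w} (Sheaf J (ModuleCat.{w} S))]

omit [HasSheafify J (ModuleCat.{w} R)] in
include hφ hker in
/-- **Acyclicity of `res I` for an injective sheaf of `R`-modules `I`** (the substitute for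
"injective ↦ flabby" in Milne III Ex. 2.25), for `φ : S ↠ R = S/(a)` and an exact pair `(a, b)`:
`Hᵐ_S(X, res I) = 0` for `m ≥ 1`. Proof: embed `res I ↪ I₀` (injective over `S`); the adjoint
`I → coind I₀` is a mono out of an injective object, hence split, so `res I` is a retract of
`res (coind I₀) ≅ I₀[a]`, which is acyclic (`eq_zero_kernel_smul_of_injective`). [cite: Milne2025, III Exercise 2.25] -/
theorem eq_zero_restrictScalars_of_injective {T : C} (hT : IsTerminal T) {b : S} (hab : a * b = 0)
    (ha : ∀ s : S, s * a = 0 → ∃ t, s = t * b) (hb : ∀ s : S, s * b = 0 → ∃ t, s = t * a)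
    (I : Sheaf J (ModuleCat.{w} R)) [Injective I] (m : ℕ)
    (x : linearCohomology S ((restrictScalarsSheaf J φ).obj I) (m + 1)) : x = 0 := by
  -- injective hull of `res I` over `S`
  let I₀ := Injective.under ((restrictScalarsSheaf J φ).obj I)
  let ι₀ : (restrictScalarsSheaf J φ).obj I ⟶ I₀ := Injective.ι _
  -- the adjoint `g : I → coind I₀` is a split mono
  let adj := restrictCoextendScalarsSheafAdj J φ
  let g : I ⟶ (coextendScalarsSheaf J φ).obj I₀ := adj.homEquiv _ _ ι₀
  haveI : Mono g := mono_homEquiv_of_faithful adj ι₀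
  obtain ⟨ρ, hρ⟩ := Injective.factors (𝟙 I) g
  -- hence `res I` is a retract of `res (coind I₀) ≅ kernel (a • 𝟙 I₀)`
  refine linearCohomology.eq_zero_of_retract ((restrictScalarsSheaf J φ).map g)
    ((restrictScalarsSheaf J φ).map ρ)
    (by rw [← Functor.map_comp, hρ, CategoryTheory.Functor.map_id]) (m + 1)
    (fun y => ?_) x
  haveI := isIso_kernelLift_coindCounit φ hφ hker I₀
  exact linearCohomology.eq_zero_of_iso (asIso (kernel.lift (a • 𝟙 I₀) (coindCounit J φ I₀)
    (coindCounit_comp_smul_id φ (by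
      rw [← RingHom.mem_ker, hker]; exact Ideal.mem_span_singleton_self a) I₀))) (m + 1)
    (eq_zero_kernel_smul_of_injective hT I₀ hab ha hb m).1 y

end RestrictInjective

/-! ### The comparison map `c : Hⁿ_R(X, G) → Hⁿ_S(X, res G)` and its bijectivity -/

section Comparison

variable {S R : Type w} [CommRing S] [CommRing R] (φ : S →+* R)
variable [HasSheafify J (ModuleCat.{w} S)] [HasSheafify J (ModuleCat.{w} R)]
variable {T : C} (hT : IsTerminal T)

/-- The unit section `u = η_R(1) ∈ R_X(T)` of the constant sheaf `R_X`, as an element of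
`(res R_X)(T)`. [folklore] -/
def unitSection : ((restrictScalarsSheaf J φ).obj (constantSheafSelf J R)).obj.obj (op T) :=
  ((constantSheafAdj J (ModuleCat.{w} R) hT).unit.app (ModuleCat.of R R)).hom (1 : R)

/-- The `S`-linear map `θ : S → (res R_X)(T)`, `s ↦ s · u = φ(s) u`. [folklore] -/
def changeOfRingsUnitHom :
    ModuleCat.of S S ⟶ ((restrictScalarsSheaf J φ).obj (constantSheafSelf J R)).obj.obj (op T) :=
  ModuleCat.ofHom (X := ModuleCat.of S S)
    (Y := ((restrictScalarsSheaf J φ).obj (constantSheafSelf J R)).obj.obj (op T))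
    (LinearMap.toSpanSingleton S
      (((restrictScalarsSheaf J φ).obj (constantSheafSelf J R)).obj.obj (op T)) (unitSection φ hT))

/-- **The canonical map `r : S_X ⟶ res R_X`** of sheaves of `S`-modules (adjoint to
`θ : S → (res R_X)(T) = R_X(T)`, `1 ↦ η_R(1)`; on stalks it is `φ`). [folklore] -/
def changeOfRingsUnit :
    constantSheafSelf J S ⟶ (restrictScalarsSheaf J φ).obj (constantSheafSelf J R) :=
  ((constantSheafAdj J (ModuleCat.{w} S) hT).homEquiv _ _).symm (changeOfRingsUnitHom φ hT)

variable [HasExt.{w} (Sheaf J (ModuleCat.{w} S))] [HasExt.{w} (Sheaf J (ModuleCat.{w} R))]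

/-- **The change-of-rings map `c : Hⁿ_R(X, G) →+ Hⁿ_S(X, res G)`**, `y ↦ r ∪ res(y)`: the exact
functor `res` on `Ext` (Mathlib `Functor.mapExtAddHom`) followed by precomposition with
`r : S_X → res R_X` (Milne III Ex. 2.25: the map `Hᵖ(X, A, M) → Hᵖ(X, M)` extending the identity
of `H⁰ = Γ`). [cite: Milne2025, III Exercise 2.25] -/
def changeOfRingsMap (G : Sheaf J (ModuleCat.{w} R)) (n : ℕ) :
    linearCohomology R G n →+ linearCohomology S ((restrictScalarsSheaf J φ).obj G) n :=
  ((Ext.mk₀ (changeOfRingsUnit φ hT)).precomp _ (zero_add n)).comp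
    ((restrictScalarsSheaf J φ).mapExtAddHom (constantSheafSelf J R) G n)

/-- The formula `c(y) = r ∪ res(y)`. [folklore] -/
theorem changeOfRingsMap_apply (G : Sheaf J (ModuleCat.{w} R)) (n : ℕ) (y : linearCohomology R G n) :
    changeOfRingsMap φ hT G n y =
      (Ext.mk₀ (changeOfRingsUnit φ hT)).comp
        (y.mapExactFunctor (restrictScalarsSheaf J φ)) (zero_add n) :=
  rfl

/-- `c` in degree `0` on `mk₀ g`: `c(g) = r ≫ res(g)`. [folklore] -/
theorem changeOfRingsMap_mk₀ (G : Sheaf J (ModuleCat.{w} R)) (g : constantSheafSelf J R ⟶ G) :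
    changeOfRingsMap φ hT G 0 (Ext.mk₀ g) =
      Ext.mk₀ (changeOfRingsUnit φ hT ≫ (restrictScalarsSheaf J φ).map g) := by
  rw [changeOfRingsMap_apply, Ext.mapExactFunctor_mk₀, Ext.mk₀_comp_mk₀]

/-- **`c` is natural** in the sheaf: `c ∘ Hⁿ(ψ) = Hⁿ(res ψ) ∘ c`. [folklore] -/
theorem changeOfRingsMap_map {G G' : Sheaf J (ModuleCat.{w} R)} (ψ : G ⟶ G') (n : ℕ)
    (y : linearCohomology R G n) :
    changeOfRingsMap φ hT G' n (linearCohomology.map ψ n y) =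
      linearCohomology.map ((restrictScalarsSheaf J φ).map ψ) n (changeOfRingsMap φ hT G n y) := by
  simp only [changeOfRingsMap_apply, linearCohomology.map_apply, Ext.mapExactFunctor_comp,
    Ext.mapExactFunctor_mk₀, Ext.comp_assoc_of_third_deg_zero]

/-- **`c` commutes with connecting homomorphisms** (`res` is exact, so `res S` is short exact):
`c(δ_S y) = δ_{res S}(c y)`; i.e. `c` is a morphism of `δ`-functors. [folklore] -/
theorem changeOfRingsMap_delta {S' : ShortComplex (Sheaf J (ModuleCat.{w} R))} (hS' : S'.ShortExact)
    (n : ℕ) (y : linearCohomology R S'.X₃ n) :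
    changeOfRingsMap φ hT S'.X₁ (n + 1) (linearCohomology.delta hS' n y) =
      linearCohomology.delta (hS'.map_of_exact (restrictScalarsSheaf J φ)) n
        (changeOfRingsMap φ hT S'.X₃ n y) := by
  rw [changeOfRingsMap_apply, changeOfRingsMap_apply, linearCohomology.delta_apply,
    linearCohomology.delta_apply, Ext.mapExactFunctor_comp, Ext.mapExactFunctor_extClass]
  exact (Ext.comp_assoc _ _ _ (zero_add n) rfl (by omega)).symm

/-- **`c` and cup products**: `c(x ∪ y) = c(x) ∘ res(y)` (`res` preserves Yoneda composition).
This is the identity behind the multiplicativity of the transition maps of the `ℓ`-adic tower.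
[folklore] -/
theorem changeOfRingsMap_cup {G : Sheaf J (ModuleCat.{w} R)} {i j n : ℕ} (h : i + j = n)
    (x : linearCohomology R (constantSheafSelf J R) i) (y : linearCohomology R G j) :
    changeOfRingsMap φ hT G n (linearCohomology.cup h x y) =
      (changeOfRingsMap φ hT _ i x).comp (y.mapExactFunctor (restrictScalarsSheaf J φ)) h := by
  rw [changeOfRingsMap_apply, changeOfRingsMap_apply, linearCohomology.cup_apply,
    Ext.mapExactFunctor_comp]
  exact (Ext.comp_assoc _ _ _ (zero_add i) h (by omega)).symm

/-- `c(1) = r`. [folklore] -/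
theorem changeOfRingsMap_one :
    changeOfRingsMap φ hT _ 0 (linearCohomology.one J R) = Ext.mk₀ (changeOfRingsUnit φ hT) := by
  rw [linearCohomology.one, changeOfRingsMap_mk₀, CategoryTheory.Functor.map_id, Category.comp_id]

set_option backward.isDefEq.respectTransparency false in
/-- **`c` in degree `0` is the identity of `G(T)`** under `H⁰_R(X, G) ≅ G(T) ≅ H⁰_S(X, res G)`:
`(r ≫ res g)` and `g` have the same section `g_T(η_R(1))` at `1`. [folklore] -/
theorem linearCohomologyZeroEquiv_changeOfRingsMap (G : Sheaf J (ModuleCat.{w} R))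
    (x : linearCohomology R G 0) :
    (linearCohomologyZeroEquiv hT ((restrictScalarsSheaf J φ).obj G) (changeOfRingsMap φ hT G 0 x) :
        G.obj.obj (op T)) = linearCohomologyZeroEquiv hT G x := by
  obtain ⟨g, rfl⟩ := (Ext.mk₀_bijective _ _).2 x
  rw [changeOfRingsMap_mk₀, linearCohomologyZeroEquiv_mk₀, linearCohomologyZeroEquiv_mk₀,
    Adjunction.homEquiv_naturality_right, changeOfRingsUnit, Equiv.apply_symm_apply,
    Adjunction.homEquiv_unit]
  change ((restrictScalarsSheaf J φ).map g).hom.app (op T)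
      (LinearMap.toSpanSingleton S
        (((restrictScalarsSheaf J φ).obj (constantSheafSelf J R)).obj.obj (op T))
        (unitSection φ hT) (1 : S)) = _
  rw [LinearMap.toSpanSingleton_apply, one_smul]
  rfl

/-- **`c` is bijective in degree `0`.** [folklore] -/
theorem bijective_changeOfRingsMap_zero (G : Sheaf J (ModuleCat.{w} R)) :
    Function.Bijective (changeOfRingsMap φ hT G 0) := by
  let eR := linearCohomologyZeroEquiv hT G
  let eS := linearCohomologyZeroEquiv hT ((restrictScalarsSheaf J φ).obj G)
  have key : ∀ x, (eS (changeOfRingsMap φ hT G 0 x) : G.obj.obj (op T)) = eR x :=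
    linearCohomologyZeroEquiv_changeOfRingsMap φ hT G
  constructor
  · intro x x' h
    apply eR.injective
    rw [← key, ← key, h]
  · intro y
    refine ⟨eR.symm (show G.obj.obj (op T) from eS y), eS.injective ?_⟩
    exact (key _).trans (eR.apply_symm_apply _)

variable [IsGrothendieckAbelian.{w} (Sheaf J (ModuleCat.{w} S))]
  [IsGrothendieckAbelian.{w} (Sheaf J (ModuleCat.{w} R))]

/-- **Change of rings for sheaf cohomology (Milne III Ex. 2.25, tower case).** For `φ : S ↠ R`
surjective with kernel `(a)`, `(a, b)` an exact pair of `S` (`ab = 0`, `ann(a) ⊆ (b)`,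
`ann(b) ⊆ (a)`), a site with a final object, and any sheaf of `R`-modules `G`, the map
`c : Hⁿ_R(X, G) → Hⁿ_S(X, res G)` is **bijective** for all `n`: the cohomology of `G` may be
computed in sheaves of `S`-modules. Induction on `n` along `G ↪ I ↠ I/G` with `I` injective,
using that `c` is a `δ`-morphism bijective in degree `0` and that `Hⁿ⁺¹_S(res I) = 0`
(`eq_zero_restrictScalars_of_injective`). [cite: Milne2025, III Exercise 2.25] -/
theorem bijective_changeOfRingsMap (hφ : Function.Surjective φ) {a b : S}
    (hker : RingHom.ker φ = Ideal.span {a}) (hab : a * b = 0)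
    (ha : ∀ s : S, s * a = 0 → ∃ t, s = t * b) (hb : ∀ s : S, s * b = 0 → ∃ t, s = t * a)
    (n : ℕ) (G : Sheaf J (ModuleCat.{w} R)) :
    Function.Bijective (changeOfRingsMap φ hT G n) := by
  induction n generalizing G with
  | zero => exact bijective_changeOfRingsMap_zero φ hT G
  | succ n ih =>
    -- `G ↪ I ↠ Q` with `I` injective, and its (short exact) restriction
    let S' : ShortComplex (Sheaf J (ModuleCat.{w} R)) :=
      ShortComplex.mk (Injective.ι G) (cokernel.π (Injective.ι G)) (by simp)
    have hS' : S'.ShortExact :=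
      { exact := ShortComplex.exact_cokernel _
        mono_f := Injective.ι_mono G
        epi_g := coequalizer.π_epi }
    have hS'' := hS'.map_of_exact (restrictScalarsSheaf J φ)
    have hI : ∀ y : linearCohomology S ((restrictScalarsSheaf J φ).obj S'.X₂) (n + 1), y = 0 :=
      eq_zero_restrictScalars_of_injective φ hφ hker hT hab ha hb (Injective.under G) n
    constructor
    · -- injectivity
      intro y y' hyy'
      rw [← sub_eq_zero] at hyy' ⊢
      rw [← map_sub] at hyy'
      generalize y - y' = z at hyy' ⊢
      -- `z = δ q` since `Hⁿ⁺¹_R(I) = 0`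
      obtain ⟨q, rfl⟩ := ((linearCohomology.exact_delta_map hS' n) z).1 (Subsingleton.elim _ _)
      -- `c q` lies in the image of `Hⁿ_S(res I)`, which is the image of `Hⁿ_R(I)`
      have hq0 : linearCohomology.delta hS'' n (changeOfRingsMap φ hT S'.X₃ n q) = 0 := by
        rw [← changeOfRingsMap_delta]
        exact hyy'
      obtain ⟨w, hw⟩ := ((linearCohomology.exact_map_delta hS'' n) _).1 hq0
      obtain ⟨i, rfl⟩ := (ih S'.X₂).2 w
      change linearCohomology.map ((restrictScalarsSheaf J φ).map S'.g) n
        (changeOfRingsMap φ hT S'.X₂ n i) = _ at hw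
      rw [← changeOfRingsMap_map] at hw
      have hq : q = linearCohomology.map S'.g n i := ((ih S'.X₃).1 hw).symm
      rw [hq]
      exact linearCohomology.delta_map_eq_zero hS' n i
    · -- surjectivity
      intro z
      obtain ⟨w, rfl⟩ := ((linearCohomology.exact_delta_map hS'' n) z).1 (hI _)
      obtain ⟨q, rfl⟩ := (ih S'.X₃).2 w
      exact ⟨linearCohomology.delta hS' n q, changeOfRingsMap_delta φ hT hS' n q⟩

/-- **`Hⁿ_R(X, G) ≃+ Hⁿ_S(X, res G)`** (the bijection `c` as an additive equivalence).
[cite: Milne2025, III Exercise 2.25] -/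
def changeOfRingsEquiv (hφ : Function.Surjective φ) {a b : S}
    (hker : RingHom.ker φ = Ideal.span {a}) (hab : a * b = 0)
    (ha : ∀ s : S, s * a = 0 → ∃ t, s = t * b) (hb : ∀ s : S, s * b = 0 → ∃ t, s = t * a)
    (G : Sheaf J (ModuleCat.{w} R)) (n : ℕ) :
    linearCohomology R G n ≃+ linearCohomology S ((restrictScalarsSheaf J φ).obj G) n :=
  AddEquiv.ofBijective _ (bijective_changeOfRingsMap φ hT hφ hker hab ha hb n G)

end Comparison

/-! ### The reduction map `ρ : Hⁿ(X, S) → Hⁿ(X, R)` is a ring homomorphism -/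

section Reduction

variable {S R : Type w} [CommRing S] [CommRing R] (φ : S →+* R)
variable [HasSheafify J (ModuleCat.{w} S)] [HasSheafify J (ModuleCat.{w} R)]
variable [IsGrothendieckAbelian.{w} (Sheaf J (ModuleCat.{w} S))]
  [IsGrothendieckAbelian.{w} (Sheaf J (ModuleCat.{w} R))]
variable {T : C} (hT : IsTerminal T) (hφ : Function.Surjective φ) {a b : S}
  (hker : RingHom.ker φ = Ideal.span {a}) (hab : a * b = 0)
  (ha : ∀ s : S, s * a = 0 → ∃ t, s = t * b) (hb : ∀ s : S, s * b = 0 → ∃ t, s = t * a)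

/-- **The reduction of coefficients `ρ : Hⁿ(X, S) → Hⁿ(X, R)`** along `φ : S ↠ R = S/(a)`
(`(a, b)` exact): `Hⁿ_S(X, S_X) → Hⁿ_S(X, res R_X)` (functoriality in the coefficient sheaf along
`r : S_X → res R_X`) followed by the inverse of the change-of-rings bijection
`c : Hⁿ_R(X, R_X) ≅ Hⁿ_S(X, res R_X)`. For `ℤ/ℓᵐ⁺¹ ↠ ℤ/ℓᵐ` these are the transition maps of the
`ℓ`-adic tower `(Hⁿ(X_ét, ℤ/ℓᵐ))ₘ` with their ring structures. [cite: Milne2025, III Exercise 2.25] -/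
def reductionMap (n : ℕ) :
    linearCohomology S (constantSheafSelf J S) n →+ linearCohomology R (constantSheafSelf J R) n :=
  (changeOfRingsEquiv φ hT hφ hker hab ha hb (constantSheafSelf J R) n).symm.toAddMonoidHom.comp
    (linearCohomology.map (changeOfRingsUnit φ hT) n).toAddMonoidHom

/-- The defining property of `ρ`: `c(ρ x) = Hⁿ(r)(x)`. [folklore] -/
theorem changeOfRingsMap_reductionMap (n : ℕ) (x : linearCohomology S (constantSheafSelf J S) n) :
    changeOfRingsMap φ hT _ n (reductionMap φ hT hφ hker hab ha hb n x) =
      linearCohomology.map (changeOfRingsUnit φ hT) n x :=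
  (changeOfRingsEquiv φ hT hφ hker hab ha hb (constantSheafSelf J R) n).apply_symm_apply _

/-- **`ρ` is multiplicative**: `ρ(x ∪ x′) = ρ(x) ∪ ρ(x′)` — from `c(y ∪ y′) = c(y) ∘ res(y′)`,
`c(ρ x′) = x′ ∘ r`, `Hⁿ(r)(x ∪ x′) = x ∪ Hⁿ(r)(x′)` and the injectivity of `c`. [folklore] -/
theorem reductionMap_cup {i j n : ℕ} (h : i + j = n)
    (x : linearCohomology S (constantSheafSelf J S) i)
    (x' : linearCohomology S (constantSheafSelf J S) j) :
    reductionMap φ hT hφ hker hab ha hb n (linearCohomology.cup h x x') =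
      linearCohomology.cup h (reductionMap φ hT hφ hker hab ha hb i x)
        (reductionMap φ hT hφ hker hab ha hb j x') := by
  apply (bijective_changeOfRingsMap φ hT hφ hker hab ha hb n _).1
  have key := changeOfRingsMap_reductionMap φ hT hφ hker hab ha hb j x'
  rw [changeOfRingsMap_apply, linearCohomology.map_apply] at key
  rw [changeOfRingsMap_reductionMap, changeOfRingsMap_cup, changeOfRingsMap_reductionMap,
    linearCohomology.map_apply, linearCohomology.map_apply, linearCohomology.cup_apply,
    Ext.comp_assoc _ _ _ (add_zero i) (zero_add j) (by omega), key,
    ← Ext.comp_assoc _ _ _ h (add_zero j) (by omega)]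

/-- **`ρ(1) = 1`.** [folklore] -/
theorem reductionMap_one :
    reductionMap φ hT hφ hker hab ha hb 0 (linearCohomology.one J S) = linearCohomology.one J R := by
  apply (bijective_changeOfRingsMap φ hT hφ hker hab ha hb 0 _).1
  rw [changeOfRingsMap_reductionMap, changeOfRingsMap_one, linearCohomology.one,
    linearCohomology.map_apply, Ext.mk₀_comp_mk₀, Category.id_comp]

end Reduction

end Literature.AlgebraicGeometry.Motives
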